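import Literature.AlgebraicGeometry.Frobenioids.Thm36SubIstrTypesQ
import Literature.AlgebraicGeometry.Frobenioids.Thm36SubProofs
import Literature.AlgebraicGeometry.Frobenioids.ArchimedeanIndissectibleAngular
import Literature.AlgebraicGeometry.Frobenioids.PerfectionCoAngularDivisors
import Literature.AlgebraicGeometry.Frobenioids.PerfectionIsos
import Literature.AlgebraicGeometry.Frobenioids.FrobeniusTypePrime
import HarnessLib

/-!
# Frobenioids II, Theorem 3.6 (ix) for `C^ℚ := C^pf` over a COMPLEXIFIABLE base — "`(C^Λ)^istr` is of
# strongly indissectible type", PROVED over THE perfection in the complexifiable case (slot `Thm36Sub.ix_Q`)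

Mochizuki, *The geometry of Frobenioids II: poly-Frobenioids*, Kyushu J. Math. **62** (2008) 401–460, §3,
Theorem 3.6 (ix), kurims text `paper:url-4322d76898e0` p. 38: "Suppose that `D` is of strongly indissectible
type. [If `D` is not complexifiable, then we assume further that `Λ ≠ ℤ`.] Then `(C^Λ)^istr` is also of strongly
indissectible type", printed proof (p. 39): "in light of the 'tip tending to zero' argument of Example 3.3 (iv),
from the fact that `D` is of strongly indissectible type, and the easily verified fact that `(C^Λ_0)^istr[ℂ]`,
`(C^Λ_0)^istr[ℝ]` [`Λ ≠ ℤ` in the real case] are of strongly indissectible type" — here for `Λ = ℚ`, i.e.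
`C^ℚ := C^pf` THE perfection (Example 3.3 (ii) p. 28, [FrdI] Def. 3.1 (iii)), in the case where the base
`π : D → D₀` is COMPLEXIFIABLE (Def. 3.1 (v)) [cite: MochizukiFrdII2008, Thm 3.6 (ix) p.38].

PROOF-ONLY companion of the sub-DAG statements file `Thm36Sub.lean` (abc-iut cell, layer L1, row M13, slot
`Thm36Sub.ix_Q`; statements abc-iut-w4-d074, proof abc-iut-w5-d161).  HONEST SCOPE: the closing theorem
`ix_Q_of_isComplexifiable` carries the binder `hcx : RC.IsComplexifiable (π ⋙ D0.toArchBase)`; the residual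
case of the slot — `D` of strongly indissectible type but NOT complexifiable, where print's proviso is void for
`Λ = ℚ` — needs the square of step (3) below over a REAL corner with real scalars, which exists only after passing
to an EVEN Frobenius level of `C^pf` (sign bookkeeping on the scalars of the transported representatives: for both
Frobenius degrees even the ratio of the two scalars becomes positive); it is NOT proved here.

Route (reduction to `C`, then the `Λ = ℤ` theorem `Indissect.thm36ix_C` of seats abc-iut-L5-d3 / L1-t14 as a
black box — legitimate exactly because `D` is complexifiable):
(1) a cospan `φᵢ : (Xᵢ, nᵢ) → (A, n)` (`i = 0, 1`) of `C^pf` is represented, at levels `(aᵢ, b)` with a COMMON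
    target exponent `b` and all exponents divisible by the isotropy periods of Example 3.3 (ii) (`C` is of
    Frobenius-isotropic type, `exists_dvd_isIsotropic_frobPow`), by a cospan `rᵢ : Xᵢ^{(aᵢ)} → A^{(b)}` of
    ISOTROPIC objects of `C` (`PreFrobenioid.Perfection.Hom.mk_lift`);
(2) `C^istr` is of strongly indissectible type (`Indissect.thm36ix_C`), so some `kᵢ : B → Xᵢ^{(aᵢ)}` in `C^istr`
    complete the square (`Indissect.exists_square`);
(3) the classes `ψᵢ := [(1, aᵢ; B^{(1)} ≅ B → Xᵢ^{(aᵢ)})] : (B, n·b) → (Xᵢ, nᵢ)` complete the square in `C^pf`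
    (composition of aligned representatives is composition in `C`, `mk_comp_mk_aligned`);
(4) every object of (any full subcategory of) `C^pf` is non-initial (`isNonemptyObj_pf`: it carries an
    endomorphism of Frobenius degree `2`, namely an isomorphism onto its formal square root — base-isomorphic
    objects of `C^pf` are isomorphic, `nonempty_iso_of_baseIso` — followed by the squaring map
    `PreFrobenioid.Perfection.exists_frobeniusType_to`), and every object of `C^pf` is isotropic (`istrAll_Q_holds`).

Classical ([FrdII] §3 is a refereed preparatory paper); nothing here takes a side on [IUTchIII] Cor. 3.12.
No statement of the paper is strengthened; the non-complexifiable case is left open, as said.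
-/

noncomputable section

namespace Literature.AlgebraicGeometry.Frobenioids

open CategoryTheory Opposite

universe v u

namespace ArchFrd

namespace Thm36Sub

variable {D : Type u} [Category.{v} D] (π : D ⥤ D0)

/-! ### Step (4): every object of `C^pf` is non-initial -/

/-- Every object `Z` of `C^pf` has an endomorphism of Frobenius degree `2`: an isomorphism onto its formal square
root `(Z.obj, 2·Z.idx)` (base-isomorphic objects of `C^pf` are isomorphic, `nonempty_iso_of_baseIso`) followed by
the squaring map `(Z.obj, 2·Z.idx) → Z` ([FrdI] Prop. 3.2 (iii), `PreFrobenioid.Perfection.exists_frobeniusType_to`).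
[cite: MochizukiFrdII2008, Thm 3.6 (ix) p.38] -/
theorem exists_end_degFr_two (hF : PreFrobenioid.IsFrobenioid (C.toElem π)) (Z : PreFrobenioid.Perfection hF) :
    ∃ e : Z ⟶ Z, PreFrobenioid.degFr (pfStr π hF) e = 2 := by
  obtain ⟨X, ρ, hρ, hdeg⟩ := PreFrobenioid.Perfection.exists_frobeniusType_to hF Z 2
  haveI : IsIso (PreFrobenioid.Base (pfStr π hF) ρ) := hρ.2
  obtain ⟨i⟩ := nonempty_iso_of_baseIso π hF X Z (asIso (PreFrobenioid.Base (pfStr π hF) ρ)).symm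
  refine ⟨i.hom ≫ ρ, ?_⟩
  rw [PreFrobenioid.degFr_comp (pfStr π hF) i.hom ρ,
    show PreFrobenioid.degFr (pfStr π hF) i.hom = 1 from PreFrobenioid.isLinear_of_isIso (pfStr π hF) i.hom,
    one_mul]
  exact hdeg

/-- **Every object of every full subcategory of `C^pf` is non-initial** (an initial object has only the identity
endomorphism, of Frobenius degree `1 ≠ 2`). [cite: MochizukiFrdII2008, Thm 3.6 (ix) p.38] -/
theorem isNonemptyObj_pf (hF : PreFrobenioid.IsFrobenioid (C.toElem π))
    (P : ObjectProperty (PreFrobenioid.Perfection hF)) (Z : P.FullSubcategory) : IsNonemptyObj Z := by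
  refine ⟨fun hI => ?_⟩
  obtain ⟨e, he⟩ := exists_end_degFr_two π hF Z.obj
  have h1 : e = 𝟙 Z.obj := congrArg InducedCategory.Hom.hom (hI.hom_ext (P.homMk e) (𝟙 Z))
  rw [h1, PreFrobenioid.degFr_id] at he
  exact absurd he (by decide)

/-! ### Theorem 3.6 (ix) for `C^ℚ = C^pf`, complexifiable base -/

/-- **Thm. 3.6 (ix) for `C^ℚ = C^pf` over a COMPLEXIFIABLE base** (p. 38): if `D` is of strongly indissectible
type [and complexifiable — binder `hcx`], then `(C^pf)^istr` is of strongly indissectible type.  PROVED by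
reduction to `C`: represent a cospan of `C^pf` by a cospan of isotropic Frobenius powers of `C` at aligned levels,
complete the square in `C^istr` (`Indissect.thm36ix_C`, `Indissect.exists_square`), and take classes at level
`(1, aᵢ)`.  The slot `Thm36Sub.ix_Q π hF` follows for complexifiable `D`; the non-complexifiable case is NOT
treated here (see the file header). [cite: MochizukiFrdII2008, Thm 3.6 (ix) p.38] -/
theorem ix_Q_of_isComplexifiable (hF : PreFrobenioid.IsFrobenioid (C.toElem π))
    (hcx : RC.IsComplexifiable (π ⋙ D0.toArchBase)) :
    Literature.AlgebraicGeometry.Frobenioids.ArchFrd.Thm36Sub.ix_Q π hF := by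
  intro hD _
  -- `C^istr` is of strongly indissectible type (Thm. 3.6 (ix) for `Λ = ℤ`, legitimate since `D` is complexifiable)
  have hC : IsOfStronglyIndissectibleType (PreFrobenioid.isotropicObjects (C.toElem π)).FullSubcategory :=
    Indissect.thm36ix_C π hD (fun h => absurd hcx h)
  refine ⟨fun Ah => ?_⟩
  rintro ⟨X, φ, -, hsep⟩
  -- (1) representatives of the cospan
  obtain ⟨r₀, hr₀⟩ := PreFrobenioid.Perfection.exists_rep (φ 0).hom
  obtain ⟨r₁, hr₁⟩ := PreFrobenioid.Perfection.exists_rep (φ 1).hom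
  obtain ⟨d₀, hd₀⟩ := exists_dvd_isIsotropic_frobPow π hF (X 0).obj.obj
  obtain ⟨d₁, hd₁⟩ := exists_dvd_isIsotropic_frobPow π hF (X 1).obj.obj
  obtain ⟨dA, hdA⟩ := exists_dvd_isIsotropic_frobPow π hF Ah.obj.obj
  -- aligned levels `(a₀, b)`, `(a₁, b)` with a common, divisible enough, target exponent `b`
  let m : ℕ+ := d₀ * d₁ * dA
  let b : ℕ+ := r₀.L.b * r₁.L.b * m
  let a₀ : ℕ+ := r₀.L.a * (r₁.L.b * m)
  let a₁ : ℕ+ := r₁.L.a * (r₀.L.b * m)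
  have e₀ : (X 0).obj.idx * a₀ = Ah.obj.idx * b := by
    change (X 0).obj.idx * (r₀.L.a * (r₁.L.b * m)) = Ah.obj.idx * (r₀.L.b * r₁.L.b * m)
    rw [← mul_assoc, r₀.L.eq, mul_assoc, mul_assoc]
  have e₁ : (X 1).obj.idx * a₁ = Ah.obj.idx * b := by
    change (X 1).obj.idx * (r₁.L.a * (r₀.L.b * m)) = Ah.obj.idx * (r₀.L.b * r₁.L.b * m)
    rw [← mul_assoc, r₁.L.eq, mul_assoc, mul_assoc, mul_left_comm r₁.L.b r₀.L.b m]
  have hle₀ : r₀.L.LE ⟨a₀, b, e₀⟩ := ⟨dvd_mul_right _ _, (dvd_mul_right r₀.L.b r₁.L.b).mul_right m⟩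
  have hle₁ : r₁.L.LE ⟨a₁, b, e₁⟩ := ⟨dvd_mul_right _ _, (dvd_mul_left r₁.L.b r₀.L.b).mul_right m⟩
  -- the transported representatives `rᵢ' : Xᵢ^{(aᵢ)} → A^{(b)}`
  let r₀' : PreFrobenioid.frobPow hF (X 0).obj.obj a₀ ⟶ PreFrobenioid.frobPow hF Ah.obj.obj b :=
    PreFrobenioid.Perfection.Level.lift r₀.L ⟨a₀, b, e₀⟩ hle₀ r₀.hom
  let r₁' : PreFrobenioid.frobPow hF (X 1).obj.obj a₁ ⟶ PreFrobenioid.frobPow hF Ah.obj.obj b :=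
    PreFrobenioid.Perfection.Level.lift r₁.L ⟨a₁, b, e₁⟩ hle₁ r₁.hom
  have hφ₀ : (φ 0).hom = PreFrobenioid.Perfection.Hom.mk
      (⟨⟨a₀, b, e₀⟩, r₀'⟩ : PreFrobenioid.Perfection.Rep (X 0).obj Ah.obj) := by
    rw [← hr₀]; exact (PreFrobenioid.Perfection.Hom.mk_lift r₀ ⟨a₀, b, e₀⟩ hle₀).symm
  have hφ₁ : (φ 1).hom = PreFrobenioid.Perfection.Hom.mk
      (⟨⟨a₁, b, e₁⟩, r₁'⟩ : PreFrobenioid.Perfection.Rep (X 1).obj Ah.obj) := by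
    rw [← hr₁]; exact (PreFrobenioid.Perfection.Hom.mk_lift r₁ ⟨a₁, b, e₁⟩ hle₁).symm
  -- the three Frobenius powers are isotropic objects of `C`
  have hm₀ : d₀ ∣ m := (dvd_mul_right d₀ d₁).mul_right dA
  have hm₁ : d₁ ∣ m := (dvd_mul_left d₁ d₀).mul_right dA
  have hmA : dA ∣ m := dvd_mul_left dA (d₀ * d₁)
  have hP₀ : PreFrobenioid.IsIsotropic (C.toElem π) (PreFrobenioid.frobPow hF (X 0).obj.obj a₀) :=
    hd₀ a₀ ((hm₀.trans (dvd_mul_left m r₁.L.b)).trans (dvd_mul_left _ r₀.L.a))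
  have hP₁ : PreFrobenioid.IsIsotropic (C.toElem π) (PreFrobenioid.frobPow hF (X 1).obj.obj a₁) :=
    hd₁ a₁ ((hm₁.trans (dvd_mul_left m r₀.L.b)).trans (dvd_mul_left _ r₁.L.a))
  have hQ : PreFrobenioid.IsIsotropic (C.toElem π) (PreFrobenioid.frobPow hF Ah.obj.obj b) :=
    hdA b (hmA.trans (dvd_mul_left m (r₀.L.b * r₁.L.b)))
  -- (2) the square in `C^istr`
  let P₁ := PreFrobenioid.isotropicObjects (C.toElem π)
  let Y₀ : P₁.FullSubcategory := ⟨_, hP₀⟩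
  let Y₁ : P₁.FullSubcategory := ⟨_, hP₁⟩
  let Q : P₁.FullSubcategory := ⟨_, hQ⟩
  let g₀ : Y₀ ⟶ Q := P₁.homMk r₀'
  let g₁ : Y₁ ⟶ Q := P₁.homMk r₁'
  let g : ∀ i : Fin 2, (![Y₀, Y₁] i ⟶ Q) := fun i =>
    match i with
    | ⟨0, _⟩ => g₀
    | ⟨1, _⟩ => g₁
  obtain ⟨Bc, k₀, k₁, hk⟩ := Indissect.exists_square hC ![Y₀, Y₁] g
  have hk' : k₀.hom ≫ r₀' = k₁.hom ≫ r₁' := congrArg InducedCategory.Hom.hom hk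
  -- (3) the object `(B, n·b)` of `C^pf` and the classes of `B^{(1)} ≅ B → Xᵢ^{(aᵢ)}` at the levels `(1, aᵢ)`
  let Bpf : PreFrobenioid.Perfection hF := ⟨Bc.obj, Ah.obj.idx * b⟩
  have n₀ : Bpf.idx * 1 = (X 0).obj.idx * a₀ := by rw [mul_one]; exact e₀.symm
  have n₁ : Bpf.idx * 1 = (X 1).obj.idx * a₁ := by rw [mul_one]; exact e₁.symm
  haveI := PreFrobenioid.isIso_of_isFrobeniusType_of_degFr_eq_one hF
    (PreFrobenioid.isFrobeniusType_frob hF Bc.obj 1) (PreFrobenioid.degFr_frob hF Bc.obj 1)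
  have hsq : (PreFrobenioid.Perfection.Hom.mk (⟨⟨1, a₀, n₀⟩, inv (PreFrobenioid.frob hF Bc.obj 1) ≫ k₀.hom⟩ :
        PreFrobenioid.Perfection.Rep Bpf (X 0).obj) ≫ (φ 0).hom : Bpf ⟶ Ah.obj) =
      PreFrobenioid.Perfection.Hom.mk (⟨⟨1, a₁, n₁⟩, inv (PreFrobenioid.frob hF Bc.obj 1) ≫ k₁.hom⟩ :
        PreFrobenioid.Perfection.Rep Bpf (X 1).obj) ≫ (φ 1).hom := by
    rw [hφ₀, hφ₁, PreFrobenioid.Perfection.mk_comp_mk_aligned, PreFrobenioid.Perfection.mk_comp_mk_aligned,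
      Category.assoc, Category.assoc]
    exact congrArg (fun t : PreFrobenioid.frobPow hF Bc.obj 1 ⟶ PreFrobenioid.frobPow hF Ah.obj.obj b =>
        PreFrobenioid.Perfection.Hom.mk (⟨⟨1, b, n₀.trans e₀⟩, t⟩ : PreFrobenioid.Perfection.Rep Bpf Ah.obj))
      (congrArg (fun t => inv (PreFrobenioid.frob hF Bc.obj 1) ≫ t) hk')
  -- (4) `(B, n·b)` is an isotropic, non-initial object of `C^pf`: contradiction with "weakly dissects"
  have hBpf : PreFrobenioid.isotropicObjects (pfStr π hF) Bpf := istrAll_Q_holds π hF (by decide) Bpf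
  exact hsep (i := 0) (j := 1) (by decide)
    (isNonemptyObj_pf π hF (PreFrobenioid.isotropicObjects (pfStr π hF)) ⟨Bpf, hBpf⟩)
    ((PreFrobenioid.isotropicObjects (pfStr π hF)).homMk
      (PreFrobenioid.Perfection.Hom.mk (⟨⟨1, a₀, n₀⟩, inv (PreFrobenioid.frob hF Bc.obj 1) ≫ k₀.hom⟩ :
        PreFrobenioid.Perfection.Rep Bpf (X 0).obj)) :
      (⟨Bpf, hBpf⟩ : (PreFrobenioid.isotropicObjects (pfStr π hF)).FullSubcategory) ⟶ X 0)
    ((PreFrobenioid.isotropicObjects (pfStr π hF)).homMk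
      (PreFrobenioid.Perfection.Hom.mk (⟨⟨1, a₁, n₁⟩, inv (PreFrobenioid.frob hF Bc.obj 1) ≫ k₁.hom⟩ :
        PreFrobenioid.Perfection.Rep Bpf (X 1).obj)))
    (InducedCategory.hom_ext hsq)

/-- The `Λ = ℚ` conjunct of t9's instance `Thm36ix_CA π pf rlf` at `pf := pfCompletion hF` — `Thm36ix` for the
structure functor of THE perfection — over a complexifiable base. [cite: MochizukiFrdII2008, Thm 3.6 (ix) p.38] -/
theorem thm36ix_pf_of_isComplexifiable (hF : PreFrobenioid.IsFrobenioid (C.toElem π))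
    (hcx : RC.IsComplexifiable (π ⋙ D0.toArchBase)) : Thm36ix (baseRC π) (pfStr π hF) .Q :=
  ix_Q_of_isComplexifiable π hF hcx

end Thm36Sub

end ArchFrd

end Literature.AlgebraicGeometry.Frobenioids

end
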